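import Summits.QuantumFields.GaugeBoot.BootstrapTranslationReductionBoxesLower
import Summits.QuantumFields.GaugeBoot.BootstrapReducedCertificatesZd
import Mathlib.Analysis.Convex.Basic
import HarnessLib

/-!
# The translation-reduced feasible values of a Wilson loop on `ℤ^d` are exactly the values feasible for all its box averages (gauge-boot, L1/L4 supplement)

HONEST FRAMING (cell `pub-gaugeboot`, page 1 of every file): the venture produces certified bounds
on lattice expectations at stated coupling, gauge group, dimension and torus size; NOT a mass gap,
NOT a continuum limit, NOT a string tension; NOT Yang–Mills-summit-bearing (barriers
`FixedCouplingUltralocality`, `PerturbativeInvisibility`). Structural; it certifies no number.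

## Content (`SU(N)` on `ℤ^d`, any real `β`, word level `n`)

* ★★ `isGreatest_symLevelValuesZd_suN` / `isLeast_symLevelValuesZd_suN` — the reduced level-`n`
  maximum and minimum of an objective of the certificate domain are ATTAINED (order-unit duality for
  the reduced cone `symCertConeZdSuN`, `OrderUnitDuality.isGreatest_gauge`; the minimum via `-P`);
* ★★ `symLevelValuesZd_eq_Icc_suN` — the reduced values form a compact interval
  `[inf, sup]` (attained extrema + convexity);
* ★★★ `symLevelValuesZd_eq_iInter_boxAvg_suN` — on `ℤ^{d+1}`, for `P` a combination of words of
  length `≤ 2n`: the set of TRANSLATION-REDUCED level-`n` feasible values of `P` IS the intersection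
  over `k` of the sets of PLAIN level-`n` feasible values of the box averages `boxAvgObs (k+1) P`
  (`⊆` at each box; `⊇` from the compact-interval structure and the two box identities
  `sSup_symLevelValuesZd_eq_iInf_boxAvg_suN`, `sInf_symLevelValuesZd_eq_iSup_boxAvg_suN`). On the
  torus the analogue is the single identity with the full lattice average
  (`symLevelValues_eq_levelValues_avgObs_suN`).

What this is NOT: whether finitely many boxes suffice; rates; reflections.

References: as in `BootstrapTranslationReductionBoxes`; C. Josz, D. Henrion, Optim. Lett. 10 (2016) 3
(attainment via order-unit duality). Folklore.
-/

noncomputable section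

open MeasureTheory Filter Topology NormedSpace
open Literature.MathematicalPhysics.QuantumFieldTheory (LatticeRep)
open Literature.MathematicalPhysics.QuantumLattice

namespace Summit.QuantumFields.GaugeBoot

open OrderUnitDuality

section ZdSuN

variable {d : ℕ} (N : ℕ) (β : ℝ)

/-- ★★ **The reduced maximum is attained**: `sup symLevelValues_n(P)` is a reduced value, for `P` in the
level-`n` certificate domain. [folklore] -/
theorem isGreatest_symLevelValuesZd_suN {n : ℕ} {P : C(LGConfig d (Matrix.specialUnitaryGroup (Fin N) ℂ), ℝ)}
    (hP : P ∈ certDomainZdSuN (d := d) N β n) :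
    IsGreatest (symLevelValuesZdSuN (d := d) N β n P) (sSup (symLevelValuesZdSuN (d := d) N β n P)) := by
  have h := isGreatest_gauge (certDomainZdSuN (d := d) N β n) (symCertCone_le_certDomain_suN N β n)
    (symCertCone_orderUnit_suN N β n).1 (symCertCone_orderUnit_suN N β n).2
    (exists_isDualFeasible_symCertCone_suN N β n) hP
  rw [← symLevelValuesZd_eq_setOf_isDualFeasible_suN] at h
  rwa [h.csSup_eq]

/-- ★★ **The reduced minimum is attained.** [folklore] -/
theorem isLeast_symLevelValuesZd_suN {n : ℕ} {P : C(LGConfig d (Matrix.specialUnitaryGroup (Fin N) ℂ), ℝ)}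
    (hP : P ∈ certDomainZdSuN (d := d) N β n) :
    IsLeast (symLevelValuesZdSuN (d := d) N β n P) (sInf (symLevelValuesZdSuN (d := d) N β n P)) := by
  have hnP : -P ∈ certDomainZdSuN (d := d) N β n := (certDomainZdSuN (d := d) N β n).neg_mem hP
  have h := isGreatest_symLevelValuesZd_suN N β hnP
  rw [symLevelValuesZd_neg_suN] at h
  set S := symLevelValuesZdSuN (d := d) N β n P
  have hL : IsLeast S (-sSup (-S)) := by
    refine ⟨?_, fun t ht => ?_⟩
    · have hm := h.1
      rw [Set.mem_neg] at hm
      exact hm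
    · have hb := h.2 (Set.neg_mem_neg.2 ht)
      linarith
  rwa [hL.csInf_eq]

/-- ★★ **The reduced values form a compact interval `[inf, sup]`.** [folklore] -/
theorem symLevelValuesZd_eq_Icc_suN {n : ℕ} {P : C(LGConfig d (Matrix.specialUnitaryGroup (Fin N) ℂ), ℝ)}
    (hP : P ∈ certDomainZdSuN (d := d) N β n) :
    symLevelValuesZdSuN (d := d) N β n P =
      Set.Icc (sInf (symLevelValuesZdSuN (d := d) N β n P)) (sSup (symLevelValuesZdSuN (d := d) N β n P)) := by
  have hG := isGreatest_symLevelValuesZd_suN N β hP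
  have hL := isLeast_symLevelValuesZd_suN N β hP
  refine Set.Subset.antisymm (fun t ht => ⟨hL.2 ht, hG.2 ht⟩) ?_
  have hoc : (symLevelValuesZdSuN (d := d) N β n P).OrdConnected :=
    convex_iff_ordConnected.1 (convex_symLevelValuesZd N β n P)
  exact hoc.out hL.1 hG.1

/-- ★★★ **The translation-reduced level-`n` feasible values of a Wilson loop are exactly the values
feasible at level `n` for ALL of its box averages.** `SU(N)` on `ℤ^{d+1}`, any real `β`, any level
`n`, `P` a combination of words of length `≤ 2n`:
`symLevelValues_n(P) = ⋂_k levelValues_n(boxAvgObs (k+1) P)`. [folklore] -/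
theorem symLevelValuesZd_eq_iInter_boxAvg_suN {n : ℕ}
    {P : C(LGConfig (d + 1) (Matrix.specialUnitaryGroup (Fin N) ℂ), ℝ)}
    (hP : P ∈ wordTruncation (ι := ZdEdge (d + 1)) (fundamentalLatticeRep N) (n + n)) :
    symLevelValuesZdSuN (d := d + 1) N β n P =
      ⋂ k : ℕ, levelValuesZdSuN (d := d + 1) N β n (boxAvgObs (k + 1) P) := by
  refine Set.Subset.antisymm
    (Set.subset_iInter fun k => symLevelValuesZd_subset_levelValuesZd_boxAvg_suN N β (Nat.succ_pos k) hP) ?_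
  intro t ht
  rw [Set.mem_iInter] at ht
  have hPd : P ∈ certDomainZdSuN (d := d + 1) N β n := mem_certDomain_of_mem_wordTruncation _ hP
  have hmem : ∀ k, boxAvgObs (k + 1) P ∈ certDomainZdSuN (d := d + 1) N β n := fun k =>
    mem_certDomain_of_mem_wordTruncation _ (boxAvgObs_mem_wordTruncation (fundamentalLatticeRep N) (k + 1) hP)
  -- `t` is below every box maximum and above every box minimum
  have hup : t ≤ sSup (symLevelValuesZdSuN (d := d + 1) N β n P) := by
    rw [sSup_symLevelValuesZd_eq_iInf_boxAvg_suN N β hP]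
    exact le_ciInf fun k => le_csSup (bdd_levelValuesZd_suN N β (hmem k)).1 (ht k)
  have hlow : sInf (symLevelValuesZdSuN (d := d + 1) N β n P) ≤ t := by
    rw [sInf_symLevelValuesZd_eq_iSup_boxAvg_suN N β hP]
    refine ciSup_le fun k => csInf_le (bdd_levelValuesZd_suN N β (hmem k)).2.1 (ht k)
  rw [symLevelValuesZd_eq_Icc_suN N β hPd]
  exact ⟨hlow, hup⟩

/-- **Corollary**: a value feasible for every box average of `P` is a reduced value of `P`, and
conversely. -/
theorem mem_symLevelValuesZd_iff_forall_boxAvg_suN {n : ℕ}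
    {P : C(LGConfig (d + 1) (Matrix.specialUnitaryGroup (Fin N) ℂ), ℝ)}
    (hP : P ∈ wordTruncation (ι := ZdEdge (d + 1)) (fundamentalLatticeRep N) (n + n)) {t : ℝ} :
    t ∈ symLevelValuesZdSuN (d := d + 1) N β n P ↔
      ∀ k : ℕ, t ∈ levelValuesZdSuN (d := d + 1) N β n (boxAvgObs (k + 1) P) := by
  rw [symLevelValuesZd_eq_iInter_boxAvg_suN N β hP, Set.mem_iInter]

end ZdSuN

end Summit.QuantumFields.GaugeBoot

end
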